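import Literature.MathematicalPhysics.QuantumFieldTheory.MullerSchiemann1987.MS87Theorem3CommonSubsequence
import HarnessLib

/-!
# Müller–Schiemann, *Continuum limit of a hierarchical SU(2) lattice gauge theory in 4 dimensions*
# (CMP 110, 1987), THEOREM 3 BY THE PRINTED ROUTE (proof p.282 L.29 – p.283 L.37): «We fix the subsequence N_j such
# that (6.19) holds for n = 0, and prove (6.19) inductively for all n ∈ ℕ» — the climb through the scales by the
# continuity (i) and the injectivity (ii) of `𝒯`, with PROPERTY (ii) AS THE ONE HYPOTHESIS not discharged in the tree
# (theorems only; no definition, no named fact)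

statement-level skeleton of published theorems with citation tags; proofs where landed; nothing here is a claim about the Yang–Mills mass gap

**Citation header (reproduction of PUBLISHED work).** V. F. Müller, J. Schiemann, *Continuum limit of a hierarchical
SU(2) lattice gauge theory in 4 dimensions*, Commun. Math. Phys. **110** (1987) 261–286, doi 10.1007/BF01207367
[MullerSchiemann1987]; Theorem 3 p.282, its proof p.282 L.29 – p.283 L.37 (properties (i), (ii) of `𝒯`, the
induction over the scales), (2.11)–(2.12) p.264, (2.16)–(2.17) p.265 (held Project Euclid scan
`paper:url-96df5da18d4c`; displays read by this seat on its own 3× page renders `run/shared/lean/pub/lit-balaban/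
lit-balaban-p12/renders-cmp110ms/ms87-cmp110-pdfp022,023-journalp282,283-x3.png`). Lean lane of the lit-balaban
YM LIT SWEEP CONTEXT row X1 (register level; zero weight for any token of that table); the model is the `d = 4`
HIERARCHICAL `SU(2)` gauge model, NOT lattice Yang–Mills.

**What the paper prints (p.283 L.23–37).** *«The final steps of our proof rely on two general properties of the Migdal
transformation 𝒯, namely (i) 𝒯 is continuous (with respect to the supremum norm) on 𝒢 := {g(u) continuous class
function on G, g(u) ≥ 0, g(e₀) = 1}, and (ii) 𝒯 is injective on 𝒢₀ := {g ∈ 𝒢, g is of positive type}. Both (i) and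
(ii) are deduced from properties of [𝒯]^{1/r}, invoking for (ii) the character expansion of g. We fix the
subsequence N_j such that (6.19) holds for n = 0, and prove (6.19) inductively for all n ∈ ℕ. Assume (6.19), and thus
(6.22), at scale n. The sequence (h_{N_j}^{(−n−1)}(z)) of the preceding scale, being a normal family for z ∈ ℂ,
|Im z| < (κ/2)(β^{(−n−1)})^{−α} due to Theorem 2, has convergent subsequences, with corresponding limits (6.22) of the
Gibbs factors g_{N_j}^{(−n−1)}(u). Those are mapped onto g^{(−n)}(u) due to (i); thus there is a unique limit
g^{(−n−1)}(u) = lim_{j→∞} g_{N_j}^{(−n−1)}(u) due to (ii), which shows (6.19), (6.22) for n + 1.»*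

**What this file proves (kernel-checked, 0 sorry, standard axioms; no definition, no named fact).** On `G = SU(2)`
with the central angle `θ = arccos ∘ u₀` ((2.16)–(2.17)); `𝒢`, `𝒯_r` the sibling `MS87MigdalRecursion`'s `Migdal.InG`,
`Migdal.migdal r`; «of positive type» = the tree's `IsPosDefKernel (u, v) ↦ g(u⁻¹v)`; property (i) is the sibling's
theorem `Migdal.tendstoUniformly_migdal` (used through `Theorem3CommonSubsequence.migdal_eq_of_tendstoUniformly`);
**property (ii) is the hypothesis `hii`** of every theorem below (NOT proved in the tree).
* §1–§2 (private plumbing) the subsequence principle for locally uniform convergence on an open set; evenness /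
  `2π`-periodicity of locally uniform limits on the strip; «even + `2π`-periodic + equal on `[0, π]` ⟹ equal on `ℝ`».
* §3 every `x ∈ [0, π]` is a central angle: `u₀(e^{−ixσ₃}) = cos x`, `arccos u₀(e^{−ixσ₃}) = x` (`u0_diagPhase`,
  `arccos_u0_diagPhase`).
* §4 **«thus there is a unique limit g^{(−n−1)}(u) … due to (ii)»** (`subseq_limits_eq_of_injective`): given the
  scale-`n` convergence `g_j^{(−n)} → gₙ` uniformly, two subsequential locally uniform limits `f₁, f₂` of the
  `h_j^{(−n−1)}` (holomorphic on the strip) COINCIDE on the strip — their Gibbs factors `Re fᵢ ∘ θ` are in `𝒢₀`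
  (uniform limits: `inG_of_tendstoUniformly`, `positiveType_of_tendstoUniformly`), are both mapped onto `gₙ` by `𝒯_r`
  ((i): `migdal_eq_of_tendstoUniformly`), hence equal by (ii); so `f₁ = f₂` on the central angles `[0, π]`, on `ℝ`
  (evenness, periodicity), on the strip (identity theorem, the tree's `eqOn_setOf_abs_im_lt_of_forall_ofReal`).
  **The inductive step** (`climb_step`): normality at scale `n+1` (Theorem 2 part 4)) + the above uniqueness ⟹ the
  WHOLE sequence `h_j^{(−n−1)}` converges locally uniformly (subsequence principle).
* §5 **THEOREM 3 by the printed climb** (`theorem3_climb`): for the cutoff families as in the sibling `theorem3` (plus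
  evenness and positive type) and ANY strictly increasing `N_j` along which the scale-`0` functions converge, IF (ii)
  THEN `h_{N_j}^{(−n)}` converges locally uniformly on `{|Im z| < d_n}` to a holomorphic limit for EVERY `n` — the same
  `N_j`, no further extraction (normality from `Theorem3CommonSubsequence.thm2_part4_normal_from`).

**Readings / scope (declared).** (i) Property (ii) — injectivity of `𝒯_r` on `𝒢₀` via the character expansion — is
NOT proved here or elsewhere in the tree; it enters as the hypothesis `hii`, stated for all pairs in `𝒢₀` exactly as
printed. The unconditional common subsequence (by Cantor's diagonal) is the sibling `theorem3`; this file adds what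
(ii) buys: no extraction beyond scale `0`, and uniqueness of the higher-scale limits given the scale-`0` limit.
(ii) Symmetry (2.3) of the Gibbs factors is automatic here (`g = h ∘ arccos ∘ u₀`, `u₀(u⁻¹) = u₀(u)`; positive definite
kernels are symmetric). (iii) `G = SU(2)` throughout (the identification of `[0, π]` with the central angles is used).

**Not claimed.** Property (ii) itself; Theorems 1, 2, 4; anything about lattice Yang–Mills or the Clay problem.
-/

noncomputable section

open Filter Set Metric Function Complex
open scoped Topology Real

namespace Literature.MathematicalPhysics.QuantumFieldTheory

namespace MullerSchiemann1987

namespace Theorem3Climb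

open Literature.Analysis.Complex (isOpen_setOf_abs_im_lt eqOn_setOf_abs_im_lt_of_forall_ofReal)
open Literature.Analysis.Matrix (IsPosDefKernel)
open HeatKernel (u0 u3 diagPhase abs_u0_le_one u0_one u3_one u0_inv u0_diagPhase_mul)
open Migdal (InG migdal)
open Theorem3CommonSubsequence (thm2_part4_normal_from tendstoUniformly_gibbs_of_angle inG_of_tendstoUniformly
  migdal_eq_of_tendstoUniformly positiveType_of_tendstoUniformly abs_arccos_u0_le_pi cos_arccos_u0)

/-! ## §1 The subsequence principle for locally uniform convergence (folklore plumbing) -/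

/-- **Subsequence principle**: on an open `U ⊆ ℂ`, if every subsequence of `F` has a further subsequence converging
locally uniformly on `U` to the SAME `f`, then `F → f` locally uniformly on `U`. [folklore] -/
private theorem tendstoLocallyUniformlyOn_of_forall_subseq {U : Set ℂ} (hU : IsOpen U) {F : ℕ → ℂ → ℂ}
    {f : ℂ → ℂ} (h : ∀ ψ : ℕ → ℕ, StrictMono ψ → ∃ φ : ℕ → ℕ, StrictMono φ ∧
      TendstoLocallyUniformlyOn (fun j => F (ψ (φ j))) f atTop U) :
    TendstoLocallyUniformlyOn F f atTop U := by
  rw [tendstoLocallyUniformlyOn_iff_forall_isCompact hU]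
  intro K hKU hK
  rw [Metric.tendstoUniformlyOn_iff]
  intro ε hε
  by_contra hne
  obtain ⟨ψ, hψ, hbad⟩ := extraction_of_frequently_atTop (Filter.not_eventually.mp hne)
  obtain ⟨φ, -, hconv⟩ := h ψ hψ
  have h2 := (tendstoLocallyUniformlyOn_iff_forall_isCompact hU).mp hconv K hKU hK
  rw [Metric.tendstoUniformlyOn_iff] at h2
  obtain ⟨j, hj⟩ := (h2 ε hε).exists
  exact hbad (φ j) hj

/-- Reindexing a uniformly convergent sequence along a map tending to `atTop`. [folklore] -/
private theorem tendstoUniformly_comp_of_tendsto {X : Type*} {F : ℕ → X → ℝ} {f : X → ℝ}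
    (h : TendstoUniformly F f atTop) {ρ : ℕ → ℕ} (hρ : Tendsto ρ atTop atTop) :
    TendstoUniformly (fun j => F (ρ j)) f atTop :=
  fun u hu => hρ.eventually (h u hu)

/-! ## §2 Evenness and periodicity of locally uniform limits on the strip, and their consequence on the real axis -/

/-- A locally uniform limit of (eventually) even functions is even on the strip. [cite: MullerSchiemann1987, Thm 3
proof p.282 L.31–32, (2.12) p.264] -/
private theorem even_of_limit {d : ℝ} {F : ℕ → ℂ → ℂ} {f : ℂ → ℂ}
    (hF : TendstoLocallyUniformlyOn F f atTop {z : ℂ | |z.im| < d})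
    (heven : ∀ᶠ j in atTop, ∀ z, F j (-z) = F j z) {z : ℂ} (hz : |z.im| < d) : f (-z) = f z := by
  have hz' : |(-z).im| < d := by simpa using hz
  exact tendsto_nhds_unique ((hF.tendsto_at hz').congr' (heven.mono fun j hj => hj z)) (hF.tendsto_at hz)

/-- A locally uniform limit of (eventually) `2π`-periodic functions is `2π`-periodic on the strip.
[cite: MullerSchiemann1987, Thm 3 proof p.282 L.31–32, (2.11) p.264] -/
private theorem periodic_of_limit {d : ℝ} {F : ℕ → ℂ → ℂ} {f : ℂ → ℂ}
    (hF : TendstoLocallyUniformlyOn F f atTop {z : ℂ | |z.im| < d})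
    (hper : ∀ᶠ j in atTop, Function.Periodic (F j) (2 * π)) {z : ℂ} (hz : |z.im| < d) :
    f (z + 2 * π) = f z := by
  have hz' : |(z + 2 * π).im| < d := by simpa using hz
  exact tendsto_nhds_unique ((hF.tendsto_at hz').congr' (hper.mono fun j hj => hj z)) (hF.tendsto_at hz)

/-- Two functions, both even and `2π`-periodic at real points, that agree on `[0, π]` agree on `ℝ`. [folklore] -/
private theorem eq_on_real_of_eq_on_Icc {f₁ f₂ : ℂ → ℂ}
    (he₁ : ∀ t : ℝ, f₁ (-(t : ℂ)) = f₁ t) (he₂ : ∀ t : ℝ, f₂ (-(t : ℂ)) = f₂ t)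
    (hp₁ : ∀ t : ℝ, f₁ ((t : ℂ) + 2 * π) = f₁ t) (hp₂ : ∀ t : ℝ, f₂ ((t : ℂ) + 2 * π) = f₂ t)
    (h : ∀ x : ℝ, 0 ≤ x → x ≤ π → f₁ x = f₂ x) (t : ℝ) : f₁ t = f₂ t := by
  -- integer translates
  have key : ∀ (m : ℕ) (s : ℝ), f₁ ((s + m * (2 * Real.pi) : ℝ) : ℂ) = f₁ s ∧
      f₂ ((s + m * (2 * Real.pi) : ℝ) : ℂ) = f₂ s := by
    intro m
    induction m with
    | zero => intro s; simp
    | succ m ih =>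
        intro s
        have e : ((s + (↑(m + 1) : ℝ) * (2 * Real.pi) : ℝ) : ℂ) = ((s + m * (2 * Real.pi) : ℝ) : ℂ) + 2 * π := by
          push_cast; ring
        rw [e, hp₁, hp₂]
        exact ih s
  -- reduce `t` into `[-π, π)` modulo `2π`
  set k : ℤ := toIcoDiv Real.two_pi_pos (-Real.pi) t with hk
  set s : ℝ := toIcoMod Real.two_pi_pos (-Real.pi) t with hs
  have hsm : s ∈ Set.Ico (-Real.pi) (-Real.pi + 2 * Real.pi) := toIcoMod_mem_Ico Real.two_pi_pos (-Real.pi) t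
  have hst : s + k • (2 * Real.pi) = t := toIcoMod_add_toIcoDiv_zsmul Real.two_pi_pos (-Real.pi) t
  rw [zsmul_eq_mul] at hst
  -- `f_i t = f_i s`
  have hts : f₁ t = f₁ s ∧ f₂ t = f₂ s := by
    obtain ⟨m, hm | hm⟩ := Int.eq_nat_or_neg k
    · have := key m s
      rw [show (s + m * (2 * Real.pi) : ℝ) = t by rw [← hst, hm]; push_cast; ring] at this
      exact this
    · have := key m t
      rw [show (t + m * (2 * Real.pi) : ℝ) = s by rw [← hst, hm]; push_cast; ring] at this
      exact ⟨this.1.symm, this.2.symm⟩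
  rw [hts.1, hts.2]
  -- on `[-π, π)`: directly or after `s ↦ -s`
  by_cases hs0 : 0 ≤ s
  · exact h s hs0 (by linarith [hsm.2])
  · have h1 := h (-s) (by linarith) (by linarith [hsm.1])
    rw [show ((-s : ℝ) : ℂ) = -(s : ℂ) by push_cast; ring, he₁, he₂] at h1
    exact h1

/-! ## §3 Every point of `[0, π]` is a central angle: `arccos u₀(e^{−ixσ₃}) = x` ((2.17) at `u = e₀`) -/

/-- `u₀(e^{−ixσ₃}) = cos x`. [cite: MullerSchiemann1987, (2.17) p.265] -/
theorem u0_diagPhase (x : ℝ) : u0 (diagPhase x) = Real.cos x := by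
  have := u0_diagPhase_mul x 1
  rw [mul_one, u0_one, u3_one] at this
  rw [this]; ring

/-- Every `x ∈ [0, π]` is the central angle of `e^{−ixσ₃}`: `arccos u₀(e^{−ixσ₃}) = x`.
[cite: MullerSchiemann1987, (2.16)–(2.17) p.265] -/
theorem arccos_u0_diagPhase {x : ℝ} (h0 : 0 ≤ x) (hπ : x ≤ π) : Real.arccos (u0 (diagPhase x)) = x := by
  rw [u0_diagPhase, Real.arccos_cos h0 hπ]


/-! ## §4 «thus there is a unique limit g^{(−n−1)}(u) … due to (ii)» (p.283 L.34–36): under PROPERTY (ii) — taken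
as a HYPOTHESIS — two subsequential limits at scale `n+1` over a common convergent scale `n` coincide on the strip -/

section Climb

variable (r : ℕ) {d' : ℝ}

/-- **Uniqueness of the subsequential limits at the finer scale, given (ii).** Along a sequence of cutoffs let
`hs j = h_j^{(−n−1)}` (even, `2π`-periodic), `gs j = g_j^{(−n−1)} = hs j ∘ (arccos ∘ u₀) ∈ 𝒢` of positive type with
`𝒯_r gs j = gsn j = g_j^{(−n)}`, and let `gsn j → gₙ` uniformly on `SU(2)` (the scale-`n` convergence (6.22)). If
PROPERTY (ii) holds («𝒯 is injective on 𝒢₀ := {g ∈ 𝒢, g is of positive type}», hypothesis `hii`), then any two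
subsequential locally uniform limits `f₁`, `f₂` of `hs` that are holomorphic on the strip `{|Im z| < d′}` COINCIDE on
the strip: their Gibbs factors are in `𝒢₀` and are both mapped onto `gₙ` by `𝒯_r` (property (i)), hence are equal by
(ii); so `f₁ = f₂` on the central angles `[0, π]`, hence on `ℝ` (evenness, periodicity), hence on the strip (identity
theorem). [cite: MullerSchiemann1987, Thm 3 proof p.283 L.23–37] -/
theorem subseq_limits_eq_of_injective (hd' : 0 < d')
    (hii : ∀ g₁ g₂ : Matrix.specialUnitaryGroup (Fin 2) ℂ → ℝ, InG g₁ → InG g₂ →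
      IsPosDefKernel (fun u v => g₁ (u⁻¹ * v)) → IsPosDefKernel (fun u v => g₂ (u⁻¹ * v)) →
      migdal r g₁ = migdal r g₂ → g₁ = g₂)
    {hs : ℕ → ℂ → ℂ} {gs gsn : ℕ → Matrix.specialUnitaryGroup (Fin 2) ℂ → ℝ}
    {gn : Matrix.specialUnitaryGroup (Fin 2) ℂ → ℝ}
    (heven : ∀ᶠ j in atTop, ∀ z, hs j (-z) = hs j z) (hper : ∀ᶠ j in atTop, Function.Periodic (hs j) (2 * π))
    (hgh : ∀ᶠ j in atTop, ∀ U, (gs j U : ℂ) = hs j (Real.arccos (u0 U)))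
    (hG : ∀ᶠ j in atTop, InG (gs j)) (hpos : ∀ᶠ j in atTop, IsPosDefKernel fun u v => gs j (u⁻¹ * v))
    (hrec : ∀ᶠ j in atTop, migdal r (gs j) = gsn j) (hn : TendstoUniformly gsn gn atTop)
    {ρ₁ ρ₂ : ℕ → ℕ} (hρ₁ : Tendsto ρ₁ atTop atTop) (hρ₂ : Tendsto ρ₂ atTop atTop) {f₁ f₂ : ℂ → ℂ}
    (hf₁ : DifferentiableOn ℂ f₁ {z : ℂ | |z.im| < d'}) (hf₂ : DifferentiableOn ℂ f₂ {z : ℂ | |z.im| < d'})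
    (hc₁ : TendstoLocallyUniformlyOn (fun j => hs (ρ₁ j)) f₁ atTop {z : ℂ | |z.im| < d'})
    (hc₂ : TendstoLocallyUniformlyOn (fun j => hs (ρ₂ j)) f₂ atTop {z : ℂ | |z.im| < d'}) :
    EqOn f₁ f₂ {z : ℂ | |z.im| < d'} := by
  -- the Gibbs factors of the two limits, (6.22) along the two subsequences
  obtain ⟨hu₁, hre₁⟩ := tendstoUniformly_gibbs_of_angle (X := Matrix.specialUnitaryGroup (Fin 2) ℂ) hd'
    abs_arccos_u0_le_pi hc₁ (g := fun j => gs (ρ₁ j)) (hρ₁.eventually hgh)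
  obtain ⟨hu₂, hre₂⟩ := tendstoUniformly_gibbs_of_angle (X := Matrix.specialUnitaryGroup (Fin 2) ℂ) hd'
    abs_arccos_u0_le_pi hc₂ (g := fun j => gs (ρ₂ j)) (hρ₂.eventually hgh)
  set g₁ : Matrix.specialUnitaryGroup (Fin 2) ℂ → ℝ := fun U => (f₁ (Real.arccos (u0 U))).re
  set g₂ : Matrix.specialUnitaryGroup (Fin 2) ℂ → ℝ := fun U => (f₂ (Real.arccos (u0 U))).re
  -- both are in `𝒢₀` and mapped onto `gₙ` by `𝒯_r` (property (i))
  have hG₁ : InG g₁ := inG_of_tendstoUniformly (hρ₁.eventually hG) hu₁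
  have hG₂ : InG g₂ := inG_of_tendstoUniformly (hρ₂.eventually hG) hu₂
  have hP₁ : IsPosDefKernel fun u v => g₁ (u⁻¹ * v) := positiveType_of_tendstoUniformly (hρ₁.eventually hpos) hu₁
  have hP₂ : IsPosDefKernel fun u v => g₂ (u⁻¹ * v) := positiveType_of_tendstoUniformly (hρ₂.eventually hpos) hu₂
  have hT₁ : migdal r g₁ = gn :=
    migdal_eq_of_tendstoUniformly r (hρ₁.eventually hG) (hρ₁.eventually hrec)
      (tendstoUniformly_comp_of_tendsto hn hρ₁) hu₁
  have hT₂ : migdal r g₂ = gn :=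
    migdal_eq_of_tendstoUniformly r (hρ₂.eventually hG) (hρ₂.eventually hrec)
      (tendstoUniformly_comp_of_tendsto hn hρ₂) hu₂
  -- (ii): the Gibbs factors coincide
  have hgg : g₁ = g₂ := hii g₁ g₂ hG₁ hG₂ hP₁ hP₂ (hT₁.trans hT₂.symm)
  -- hence `f₁ = f₂` on the central angles `[0, π]`
  have hIcc : ∀ x : ℝ, 0 ≤ x → x ≤ π → f₁ x = f₂ x := by
    intro x h0 hπ
    have h1 := hre₁ (diagPhase x)
    have h2 := hre₂ (diagPhase x)
    have h3 : g₁ (diagPhase x) = g₂ (diagPhase x) := by rw [hgg]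
    simp only [g₁, g₂, arccos_u0_diagPhase h0 hπ] at h1 h2 h3
    rw [← h1, ← h2, h3]
  -- evenness and periodicity of the limits at real points
  have hreal : ∀ t : ℝ, |(t : ℂ).im| < d' := fun t => by rw [Complex.ofReal_im, abs_zero]; exact hd'
  have hE₁ : ∀ t : ℝ, f₁ (-(t : ℂ)) = f₁ t := fun t => even_of_limit hc₁ (hρ₁.eventually heven) (hreal t)
  have hE₂ : ∀ t : ℝ, f₂ (-(t : ℂ)) = f₂ t := fun t => even_of_limit hc₂ (hρ₂.eventually heven) (hreal t)
  have hPe₁ : ∀ t : ℝ, f₁ ((t : ℂ) + 2 * π) = f₁ t := fun t =>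
    periodic_of_limit hc₁ (hρ₁.eventually hper) (hreal t)
  have hPe₂ : ∀ t : ℝ, f₂ ((t : ℂ) + 2 * π) = f₂ t := fun t =>
    periodic_of_limit hc₂ (hρ₂.eventually hper) (hreal t)
  -- identity theorem from the real axis
  exact eqOn_setOf_abs_im_lt_of_forall_ofReal hd' hf₁ hf₂ (eq_on_real_of_eq_on_Icc hE₁ hE₂ hPe₁ hPe₂ hIcc)

/-- **The inductive step of the printed proof** (p.283 L.29–37): if at scale `n+1` the family is normal on the strip
`{|Im z| < d′}` (every subsequence has a locally uniformly convergent further subsequence with holomorphic limit —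
Theorem 2 part 4)), the scale-`n` Gibbs factors converge ((6.22) at scale `n`), and (i), (ii) hold ((i) proved in the
tree, (ii) the HYPOTHESIS `hii`), then the WHOLE sequence `h_j^{(−n−1)}` converges locally uniformly on the strip.
[cite: MullerSchiemann1987, Thm 3 proof p.283 L.29–37] -/
theorem climb_step (hd' : 0 < d')
    (hii : ∀ g₁ g₂ : Matrix.specialUnitaryGroup (Fin 2) ℂ → ℝ, InG g₁ → InG g₂ →
      IsPosDefKernel (fun u v => g₁ (u⁻¹ * v)) → IsPosDefKernel (fun u v => g₂ (u⁻¹ * v)) →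
      migdal r g₁ = migdal r g₂ → g₁ = g₂)
    {hs : ℕ → ℂ → ℂ} {gs gsn : ℕ → Matrix.specialUnitaryGroup (Fin 2) ℂ → ℝ}
    {gn : Matrix.specialUnitaryGroup (Fin 2) ℂ → ℝ}
    (hnormal : ∀ ψ : ℕ → ℕ, StrictMono ψ → ∃ φ : ℕ → ℕ, StrictMono φ ∧ ∃ f : ℂ → ℂ,
      DifferentiableOn ℂ f {z : ℂ | |z.im| < d'} ∧
      TendstoLocallyUniformlyOn (fun j => hs (ψ (φ j))) f atTop {z : ℂ | |z.im| < d'})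
    (heven : ∀ᶠ j in atTop, ∀ z, hs j (-z) = hs j z) (hper : ∀ᶠ j in atTop, Function.Periodic (hs j) (2 * π))
    (hgh : ∀ᶠ j in atTop, ∀ U, (gs j U : ℂ) = hs j (Real.arccos (u0 U)))
    (hG : ∀ᶠ j in atTop, InG (gs j)) (hpos : ∀ᶠ j in atTop, IsPosDefKernel fun u v => gs j (u⁻¹ * v))
    (hrec : ∀ᶠ j in atTop, migdal r (gs j) = gsn j) (hn : TendstoUniformly gsn gn atTop) :
    ∃ f : ℂ → ℂ, DifferentiableOn ℂ f {z : ℂ | |z.im| < d'} ∧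
      TendstoLocallyUniformlyOn hs f atTop {z : ℂ | |z.im| < d'} := by
  -- one subsequential limit `f⋆`
  obtain ⟨φ₀, hφ₀, fstar, hfstar, hc₀⟩ := hnormal id strictMono_id
  refine ⟨fstar, hfstar, tendstoLocallyUniformlyOn_of_forall_subseq (isOpen_setOf_abs_im_lt d') fun ψ hψ => ?_⟩
  obtain ⟨φ, hφ, f, hf, hc⟩ := hnormal ψ hψ
  refine ⟨φ, hφ, hc.congr_right ?_⟩
  exact subseq_limits_eq_of_injective r hd' hii heven hper hgh hG hpos hrec hn
    ((hψ.comp hφ).tendsto_atTop) (hφ₀.tendsto_atTop) hf hfstar hc hc₀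

end Climb

/-! ## §5 «We fix the subsequence N_j such that (6.19) holds for n = 0, and prove (6.19) inductively for all n ∈ ℕ»
(p.283 L.29–31) — THEOREM 3's common subsequence BY THE PRINTED ROUTE, with property (ii) as the one hypothesis not
discharged in the tree -/

/-- **THEOREM 3 by the printed climb (property (ii) as hypothesis).** For the cutoff families on `SU(2)` as in the
sibling `theorem3` (`h_N^{(−n)}` holomorphic and bounded by `M_n` on `{|Im z| < d_n}` (6.18), even, `2π`-periodic;
`g_N^{(−n)} = h_N^{(−n)} ∘ (arccos ∘ u₀) ∈ 𝒢` of positive type; `𝒯_r g_N^{(−n−1)} = g_N^{(−n)}`), and ANY strictly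
increasing sequence of cutoffs `N_j` along which the scale-`0` functions converge locally uniformly on their strip:
IF `𝒯_r` is injective on `𝒢₀` (property (ii), hypothesis `hii`), THEN `h_{N_j}^{(−n)}` converges locally uniformly on
`{|Im z| < d_n}` to a holomorphic limit for EVERY scale `n` — the SAME subsequence, no further extraction (the
sharper content of the printed proof, beyond the diagonal route of the sibling `theorem3`).
[cite: MullerSchiemann1987, Thm 3 p.282, proof p.282 L.29 – p.283 L.37] -/
theorem theorem3_climb (r : ℕ) {d M : ℕ → ℝ} (hd : ∀ n, 0 < d n) {h : ℕ → ℕ → ℂ → ℂ}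
    {g : ℕ → ℕ → Matrix.specialUnitaryGroup (Fin 2) ℂ → ℝ}
    (hhol : ∀ N n, n ≤ N → DifferentiableOn ℂ (h N n) {z : ℂ | |z.im| < d n})
    (hbd : ∀ N n, n ≤ N → ∀ z : ℂ, |z.im| < d n → ‖h N n z‖ ≤ M n)
    (hper : ∀ N n, n ≤ N → Function.Periodic (h N n) (2 * π))
    (heven : ∀ N n, n ≤ N → ∀ z, h N n (-z) = h N n z)
    (hgh : ∀ N n, n ≤ N → ∀ U, (g N n U : ℂ) = h N n (Real.arccos (u0 U)))
    (hG : ∀ N n, n ≤ N → InG (g N n))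
    (hpos : ∀ N n, n ≤ N → IsPosDefKernel fun u v => g N n (u⁻¹ * v))
    (hrec : ∀ N n, n + 1 ≤ N → migdal r (g N (n + 1)) = g N n)
    (hii : ∀ g₁ g₂ : Matrix.specialUnitaryGroup (Fin 2) ℂ → ℝ, InG g₁ → InG g₂ →
      IsPosDefKernel (fun u v => g₁ (u⁻¹ * v)) → IsPosDefKernel (fun u v => g₂ (u⁻¹ * v)) →
      migdal r g₁ = migdal r g₂ → g₁ = g₂)
    {Nj : ℕ → ℕ} (hNj : StrictMono Nj) {f₀ : ℂ → ℂ}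
    (h0 : TendstoLocallyUniformlyOn (fun j => h (Nj j) 0) f₀ atTop {z : ℂ | |z.im| < d 0}) :
    ∀ n, ∃ f : ℂ → ℂ, DifferentiableOn ℂ f {z : ℂ | |z.im| < d n} ∧
      TendstoLocallyUniformlyOn (fun j => h (Nj j) n) f atTop {z : ℂ | |z.im| < d n} := by
  have hev : ∀ n, ∀ᶠ j in atTop, n ≤ Nj j := fun n =>
    Filter.eventually_atTop.mpr ⟨n, fun _ hj => le_trans hj hNj.le_apply⟩
  intro n
  induction n with
  | zero =>
      refine ⟨f₀, h0.differentiableOn ((hev 0).mono fun j hj => hhol (Nj j) 0 hj) (isOpen_setOf_abs_im_lt _), h0⟩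
  | succ n ih =>
      obtain ⟨fn, -, hcn⟩ := ih
      -- (6.22) at scale `n`
      obtain ⟨hgn, -⟩ := tendstoUniformly_gibbs_of_angle (X := Matrix.specialUnitaryGroup (Fin 2) ℂ) (hd n)
        abs_arccos_u0_le_pi hcn (g := fun j => g (Nj j) n) ((hev n).mono fun j hj => hgh (Nj j) n hj)
      -- the climb step at scale `n + 1`
      refine climb_step r (hd (n + 1)) hii (hs := fun j => h (Nj j) (n + 1)) (gs := fun j => g (Nj j) (n + 1))
        (gsn := fun j => g (Nj j) n) ?_ ((hev (n + 1)).mono fun j hj => heven (Nj j) (n + 1) hj)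
        ((hev (n + 1)).mono fun j hj => hper (Nj j) (n + 1) hj)
        ((hev (n + 1)).mono fun j hj => hgh (Nj j) (n + 1) hj)
        ((hev (n + 1)).mono fun j hj => hG (Nj j) (n + 1) hj)
        ((hev (n + 1)).mono fun j hj => hpos (Nj j) (n + 1) hj)
        ((hev (n + 1)).mono fun j hj => hrec (Nj j) n hj) hgn
      -- normality at scale `n + 1` (Theorem 2 part 4))
      intro ψ hψ
      obtain ⟨φ, hφ, f, hf, hc⟩ := thm2_part4_normal_from (n + 1) (h := fun N => h N (n + 1))
        (fun N hN => hhol N (n + 1) hN) (fun N hN => hbd N (n + 1) hN) (hNj.comp hψ)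
      exact ⟨φ, hφ, f, hf, hc⟩

end Theorem3Climb

end MullerSchiemann1987

end Literature.MathematicalPhysics.QuantumFieldTheory
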